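import Literature.Barriers.ValiantsHypothesis.CKRST20ExpSumHittingSets
import Literature.Computability.AlgebraicComplexity.VNPeEqVNP
import HarnessLib

/-!
# Hitting sets of polynomial size for the `VNP`-succinct class `SmallDefinable ℂ n b` exist
# (the `VNP` analogue of Heintz–Schnorr, via CKRST 2020 v4 Lemma 3.7)

Companion of `CKRST20ExpSumHittingSets.lean` (Δ-free hitting sets for CKRST's `s`-definable slice)
in the frame of the natural-proofs barrier files: the class `SmallDefinable ℂ n b = vnpSlice ℂ n n (n^b)`
(Kumar–Ramya–Saptharishi–Tengse 2022, Def. 3: degree-`≤ n` Valiant Boolean sums of width, size and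
degree `≤ n^b` — the `VNP`-succinct class of the tree's KRST theorem
`succinctHittingSetsFromVNP_of_permanentExpHard`) admits, UNCONDITIONALLY, hitting sets of
polynomially many points with small natural coordinates:

* `vnpSlice_subset_definableSlice` — `vnpSlice F n d t ⊆ definableSlice F n d (n + t + 1)` over a
  field of characteristic `≠ 2`... here over `ℂ`: pad the Boolean block with unused variables (each
  doubles the Boolean sum) and rescale by `2^{-B}` (CKRST v2 Remark ‹15› / ECCC Remark 5.2: "every
  family in `VNP` is `s(n)`-definable for a polynomially bounded `s`");
* `exists_hittingSet_smallDefinable` — one exponent `c` such that for all `b` and `n ≥ 1` there is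
  `H ⊆ {0, …, 2(n + n^b + 1) - 1}ⁿ ⊂ ℂⁿ`, `#H ≤ (n + n^b + 1)^c`, hitting every nonzero member of
  `SmallDefinable ℂ n b`.

So the coefficient vectors of `VNP_{n,b}` do not only (conditionally, KRST) form a SUCCINCT hitting
set for `VP`-distinguishers; the class itself is unconditionally hit by `poly(n)` explicit-size
point sets — the non-succinct statement, which is all that Heintz–Schnorr-type counting gives.
Honest framing: an existence statement; nothing here bears on FSV Question 6 (succinctness) or on
VP ≠ VNP.

## References

* [ChatterjeeKumarRamyaSaptharishiTengse2020] arXiv v4 Lemma 3.7; v2 Remark ‹15› = ECCC Remark 5.2.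
* [KumarRamyaSaptharishiTengse2022] Def. 3 (`VNP_{d,s}(n)`), the class `SmallDefinable`.
* [HeintzSchnorr1980] Thm. 4.4.
-/

noncomputable section

namespace Literature.Barriers.ValiantsHypothesis

open Literature.Computability.AlgebraicComplexity MvPolynomial

namespace CKRST2020

/-! ### Padding the Boolean block: `vnpSlice ⊆ definableSlice` -/

section Padding

variable {F : Type*} [Field F]

/-- A Boolean sum over `B` unused extra variables multiplies by `2^B`. [folklore] -/
private theorem boolSum_rename_inl {σ : Type*} {B : ℕ} (g : MvPolynomial σ F) :
    boolSum (rename (Sum.inl : σ → σ ⊕ Fin B) g) = (2 ^ B : ℕ) • g := by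
  classical
  unfold boolSum
  have h : ∀ e : Fin B → Bool,
      aeval (Sum.elim X fun j => if e j then (1 : MvPolynomial σ F) else 0) (rename Sum.inl g) = g := by
    intro e
    rw [aeval_rename]
    have : ((Sum.elim X fun j => if e j then (1 : MvPolynomial σ F) else 0) ∘ Sum.inl) = X := by
      funext i; rfl
    rw [this, aeval_X_left, AlgHom.coe_id, id_eq]
  simp only [h, Finset.sum_const, Finset.card_univ, Fintype.card_fun, Fintype.card_bool,
    Fintype.card_fin]

/-- Re-indexing the Boolean block along `Fin.cast` does not change the Boolean sum. [folklore] -/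
private theorem boolSum_rename_finCongr {σ : Type*} {a a' : ℕ} (h : a = a')
    (p : MvPolynomial (σ ⊕ Fin a) F) :
    boolSum (rename (Sum.map id (finCongr h)) p) = boolSum p := by
  subst h
  have : (Sum.map id (finCongr (rfl : a = a)) : σ ⊕ Fin a → σ ⊕ Fin a) = id := by
    funext v; rcases v with i | j <;> rfl
  rw [this, rename_id]
  rfl

/-- Scalars pass through Boolean sums. [folklore] -/
private theorem boolSum_C_mul {σ : Type*} {m : ℕ} (c : F) (p : MvPolynomial (σ ⊕ Fin m) F) :
    boolSum (C c * p) = C c * boolSum p := by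
  unfold boolSum
  rw [Finset.mul_sum]
  refine Finset.sum_congr rfl fun e _ => ?_
  rw [map_mul, aeval_C, algebraMap_eq]

/-- **`vnpSlice ⊆ definableSlice` over `ℂ`** (CKRST v2 Remark ‹15› = ECCC Remark 5.2: every
`VNP`-slice member is `s`-definable for `s = n + t + 1`): pad the `m ≤ t` Boolean variables of a
witness `g` to `t + 1 = s - n` unused ones (multiplying the Boolean sum by `2^{t+1-m}`) and rescale
by `2^{-(t+1-m)}`; size `≤ t + 1 ≤ s`, degree `≤ t ≤ s`.
[cite: ChatterjeeKumarRamyaSaptharishiTengse2020, Remark 5.2 (ECCC) = v2 Remark ‹15›] -/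
theorem vnpSlice_subset_definableSlice (n d t : ℕ) :
    vnpSlice ℂ n d t ⊆ definableSlice ℂ n d (n + t + 1) := by
  classical
  rintro f ⟨hfd, m, hm, g, hgc, hgd, hfg⟩
  refine ⟨hfd, by omega, ?_⟩
  -- the padded and re-indexed witness
  set B := t + 1 - m with hB
  have hmB : m + B = n + t + 1 - n := by omega
  let E : (Fin n ⊕ Fin m) ⊕ Fin B ≃ Fin n ⊕ Fin (m + B) :=
    (Equiv.sumAssoc (Fin n) (Fin m) (Fin B)).trans (Equiv.sumCongr (Equiv.refl _) finSumFinEquiv)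
  let h : MvPolynomial ((Fin n ⊕ Fin m) ⊕ Fin B) ℂ := rename Sum.inl g
  let g₁ : MvPolynomial (Fin n ⊕ Fin (m + B)) ℂ := rename E h
  let g₂ : MvPolynomial (Fin n ⊕ Fin (n + t + 1 - n)) ℂ := rename (Sum.map id (finCongr hmB)) g₁
  have hsum₁ : boolSum g₁ = ((2 ^ B : ℕ) : ℂ) • f := by
    have h1 : boolSum (boolSum h) = boolSum g₁ := boolSum_boolSum h
    rw [← h1, boolSum_rename_inl, hfg]
    -- `boolSum` of an `ℕ`-multiple
    unfold boolSum
    rw [Finset.smul_sum]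
    refine Finset.sum_congr rfl fun e _ => ?_
    rw [map_nsmul, Nat.cast_smul_eq_nsmul]
  have hsum₂ : boolSum g₂ = ((2 ^ B : ℕ) : ℂ) • f := by
    simp only [g₂]
    rw [boolSum_rename_finCongr, hsum₁]
  refine ⟨C (((2 : ℂ)⁻¹) ^ B) * g₂, ?_, ?_, ?_⟩
  · -- degree
    refine (totalDegree_mul _ _).trans ?_
    rw [totalDegree_C, zero_add]
    refine (totalDegree_rename_le _ _).trans ((totalDegree_rename_le _ _).trans
      ((totalDegree_rename_le _ _).trans (hgd.trans (by omega))))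
  · -- size
    calc complexity (C (((2 : ℂ)⁻¹) ^ B) * g₂)
        ≤ complexity (C (((2 : ℂ)⁻¹) ^ B) : MvPolynomial _ ℂ) + complexity g₂ + 1 :=
          complexity_mul_le_holds _ _
      _ ≤ 0 + t + 1 := by
          rw [complexity_C_holds]
          refine Nat.add_le_add_right (Nat.add_le_add_left ?_ 0) 1
          exact (complexity_rename_le_holds' _ _).trans ((complexity_rename_le_holds' _ _).trans
            ((complexity_rename_le_holds' _ _).trans hgc))
      _ ≤ n + t + 1 := by omega
  · -- the Boolean sum
    rw [boolSum_C_mul, hsum₂, smul_eq_C_mul, ← mul_assoc, ← C_mul]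
    have h2 : ((2 : ℂ)⁻¹) ^ B * ((2 ^ B : ℕ) : ℂ) = 1 := by
      push_cast
      rw [← mul_pow, inv_mul_cancel₀ (two_ne_zero), one_pow]
    rw [h2, C_1, one_mul]

/-- In the tree's frame: `SmallDefinable ℂ n b ⊆ definableSlice ℂ n n (n + n^b + 1)`.
[cite: KumarRamyaSaptharishiTengse2022, Def. 3] -/
theorem smallDefinable_subset_definableSlice (n b : ℕ) :
    SmallDefinable ℂ n b ⊆ definableSlice ℂ n n (n + n ^ b + 1) := by
  rw [smallDefinable_eq_vnpSlice]
  exact vnpSlice_subset_definableSlice n n (n ^ b)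

end Padding

/-! ### Arithmetic -/

/-- `log₂((2s)ⁿ s^e + 1) + 1 ≤ (e + 3) s²` for `n ≤ s`, `s ≥ 2`. [folklore] -/
private theorem log_bound {n s e : ℕ} (hns : n ≤ s) (hs : 2 ≤ s) :
    Nat.log 2 ((2 * s) ^ n * s ^ e + 1) + 1 ≤ (e + 3) * s ^ 2 := by
  have h1s : 1 ≤ s := by omega
  have h2s : s ≤ 2 ^ s := (Nat.lt_two_pow_self).le
  have ha : (2 * s) ^ n ≤ s ^ (2 * s) := by
    calc (2 * s) ^ n ≤ (2 * s) ^ s := Nat.pow_le_pow_right (by omega) hns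
      _ ≤ (s * s) ^ s := Nat.pow_le_pow_left (by nlinarith) s
      _ = s ^ (2 * s) := by rw [← pow_two, ← pow_mul]
  have hX : (2 * s) ^ n * s ^ e + 1 < 2 ^ (s * (2 * s + e) + 1) := by
    have hb : (2 * s) ^ n * s ^ e ≤ 2 ^ (s * (2 * s + e)) := by
      calc (2 * s) ^ n * s ^ e ≤ s ^ (2 * s) * s ^ e := Nat.mul_le_mul_right _ ha
        _ = s ^ (2 * s + e) := by rw [← pow_add]
        _ ≤ (2 ^ s) ^ (2 * s + e) := Nat.pow_le_pow_left h2s _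
        _ = 2 ^ (s * (2 * s + e)) := by rw [← pow_mul]
    have hk : 1 ≤ 2 ^ (s * (2 * s + e)) := Nat.one_le_two_pow
    calc (2 * s) ^ n * s ^ e + 1 ≤ 2 ^ (s * (2 * s + e)) + 1 := Nat.add_le_add_right hb 1
      _ < 2 ^ (s * (2 * s + e)) + 2 ^ (s * (2 * s + e)) :=
          Nat.add_lt_add_left (Nat.one_lt_two_pow (by positivity)) _
      _ = 2 ^ (s * (2 * s + e) + 1) := by rw [pow_succ, mul_two]
  have hlog : Nat.log 2 ((2 * s) ^ n * s ^ e + 1) < s * (2 * s + e) + 1 :=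
    Nat.log_lt_of_lt_pow (by omega) hX
  have hss : s ≤ s ^ 2 := by nlinarith
  have h1 : 1 ≤ s ^ 2 := Nat.one_le_pow _ _ h1s
  have hfin : s * (2 * s + e) + 1 ≤ (e + 3) * s ^ 2 := by
    calc s * (2 * s + e) + 1 = 2 * s ^ 2 + e * s + 1 := by ring
      _ ≤ 2 * s ^ 2 + e * s ^ 2 + s ^ 2 := by gcongr
      _ = (e + 3) * s ^ 2 := by ring
  omega

/-- The size bound is `≤ s^(2e+4)` (`s ≥ 2`, `n ≤ s`). [folklore] -/
private theorem size_bound {n s e : ℕ} (hns : n ≤ s) (hs : 2 ≤ s) :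
    s ^ e * (Nat.log 2 ((2 * s) ^ n * s ^ e + 1) + 1) + 1 ≤ s ^ (2 * e + 4) := by
  have h1s : 1 ≤ s := by omega
  have he4 : e + 4 ≤ s ^ (e + 2) := by
    have h : ∀ k : ℕ, k + 4 ≤ 2 ^ (k + 2) := fun k => by
      induction k with
      | zero => norm_num
      | succ k ih => rw [show k + 1 + 2 = (k + 2) + 1 by omega, pow_succ]; omega
    exact (h e).trans (Nat.pow_le_pow_left hs _)
  have h1 : s ^ e * (Nat.log 2 ((2 * s) ^ n * s ^ e + 1) + 1) + 1 ≤ (e + 4) * s ^ (e + 2) := by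
    have hl := log_bound (e := e) hns hs
    have hp : 1 ≤ s ^ (e + 2) := Nat.one_le_pow _ _ h1s
    calc s ^ e * (Nat.log 2 ((2 * s) ^ n * s ^ e + 1) + 1) + 1
        ≤ s ^ e * ((e + 3) * s ^ 2) + 1 := Nat.add_le_add_right (Nat.mul_le_mul_left _ hl) 1
      _ = (e + 3) * s ^ (e + 2) + 1 := by ring
      _ ≤ (e + 4) * s ^ (e + 2) := by nlinarith
  calc s ^ e * (Nat.log 2 ((2 * s) ^ n * s ^ e + 1) + 1) + 1 ≤ (e + 4) * s ^ (e + 2) := h1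
    _ ≤ s ^ (e + 2) * s ^ (e + 2) := Nat.mul_le_mul_right _ he4
    _ = s ^ (2 * e + 4) := by rw [← pow_add]; ring_nf

/-! ### Hitting sets for `SmallDefinable ℂ n b` -/

/-- **Hitting sets of polynomial size for the `VNP`-succinct class, unconditionally.** One
exponent `c` such that for all `b` and `n ≥ 1`, writing `s = n + n^b + 1`, there is a set `H` of
at most `s^c` points of `ℂⁿ` with natural coordinates `< 2s` such that every nonzero
`f ∈ SmallDefinable ℂ n b` has `f(a) ≠ 0` for some `a ∈ H`.
[cite: ChatterjeeKumarRamyaSaptharishiTengse2020, Lemma 3.7 (arXiv v4)] -/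
theorem exists_hittingSet_smallDefinable :
    ∃ c : ℕ, ∀ (b n : ℕ), 1 ≤ n →
      ∃ H : Finset (Fin n → ℂ), H.card ≤ (n + n ^ b + 1) ^ c ∧
        (∀ a ∈ H, ∀ i, ∃ k : ℕ, k < 2 * (n + n ^ b + 1) ∧ a i = (k : ℂ)) ∧
        ∀ f ∈ SmallDefinable ℂ n b, f ≠ 0 → ∃ a ∈ H, eval a f ≠ 0 := by
  classical
  obtain ⟨e, h⟩ := exists_hittingSet_definableSlice
  refine ⟨2 * e + 4, fun b n hn => ?_⟩
  set s := n + n ^ b + 1 with hs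
  have hs2 : 2 ≤ s := by have := Nat.one_le_pow b n hn; omega
  have hns : n ≤ s := by omega
  let S : Finset ℂ := (Finset.range (2 * s)).image (fun k : ℕ => (k : ℂ))
  have hScard : S.card = 2 * s := by
    simp only [S]
    rw [Finset.card_image_of_injective _ Nat.cast_injective, Finset.card_range]
  obtain ⟨H, hHS, hHcard, hhit⟩ := h n n s hn hns hs2 S hScard.ge
  refine ⟨H, hHcard.trans ?_, fun a ha i => ?_, fun f hf hf0 => ?_⟩
  · rw [hScard]; exact size_bound hns hs2
  · obtain ⟨k, hk, hk'⟩ := Finset.mem_image.mp (hHS a ha i)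
    exact ⟨k, Finset.mem_range.mp hk, hk'.symm⟩
  · exact hhit f (smallDefinable_subset_definableSlice n b hf) hf0

end CKRST2020

end Literature.Barriers.ValiantsHypothesis

end
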